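import Summits.ValiantsHypothesis.ValiantsHypothesis.Theorems.DefinabilityGapGraphicalFour
import HarnessLib

/-!
# Definability gap — FOUR GATES WITH SHARED EDGES: the free collapse, and the sizes reduction (O-L5-SURPLUS, F-S₁)

Helper instrument for `stmt-ValiantsHypothesis-23704` (KI planted hitting, route `DefinabilityGap`), in the
restricted-model cell (α″)/(CL4) «graphical ΣΠΣ(4) circuits with shared edges»: two TOOLS for four graphical gates
`eprod E = Π_{(u,v) ∈ E} (z_u − z_v)` on ORIENTED edges under `G_m = bind₁ (kiPer m)`.

## Contents

* (E3a⁺) `kiPer_fourGates_free_shared` — FREE COLLAPSE WITH SHARED EDGES (`m ≥ 8`): if `e` lies in the first gate,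
  the other three gates have one size, and the relabel-collapse `ρ_e = rename (repL [e])` (`z_{e.2} ↦ z_{e.1}`) leaves
  `ρ_e f ≠ 0`, then `G_m` hits `f`. This is the tree's `kiPer_fourGates_free` (`DefinabilityGapFourGatesTools`)
  WITHOUT its edge-disjointness hypotheses: `e` may lie in several gates. Proof: `φ f = 0 ⟹ φ_[e] f = 0`
  (`bind₁_wordL_eq_zero_of_kiPer`, TRANSFER) and `φ_[e] ∘ ρ_e = φ_[e]` (`bind₁_wordL_rename_repL`, CONTRACT) give
  `φ_[e] (ρ_e f) = 0`; `ρ_e f = Σ_{j=2,3,4} γ_j · eprod (ρ̂_e F_j)` (`rename_repL_fourGates`); a gate containing `e`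
  DIES (`eprod_map_repL_eq_zero`, a loop), a gate avoiding `e` collapses to a loopless gate live at level `[e]`
  (`collapsed_cond`) which is re-oriented with a sign (`exists_oriented`); padding the killed slots with a surviving
  gate and coefficient `0` presents `ρ_e f` as THREE oriented live gates of one size at level `L = [e]`, where
  THEOREM A `wordL_threeGates_eqCard` (`DefinabilityGapThreeGatesPatched`; no distinctness hypothesis, zero
  coefficients allowed; `2·3³ = 54 < 64 ≤ m²`, the only use of `m ≥ 8`) forbids `φ_[e] (ρ_e f) = 0`.
* `kiPer_hits_graphicalFour_of_eqCard` — SIZES REDUCTION (`m ≥ 5`): hitting a nonzero four-gate circuit on oriented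
  edges reduces to the case of four gates of ONE size. The blocks (Z)/(S) of THEOREM B
  `kiPer_hits_graphicalFour_coprime` (`DefinabilityGapGraphicalFour`) packaged once as a parametric tool: a zero
  coefficient is graphical ΣΠΣ(3) (★ `kiPer_hits_graphicalThree`, BY NAME); for sizes not all equal the degree-
  `m·|E₁|` homogeneous component of `φ f` (`isHomogeneous_kiPer_eprod`) is `φ` of the size-class sub-circuit, which
  has a zero coefficient. No edge-disjointness anywhere.

HONEST BOUNDARY (O-L5-SURPLUS): proved here are, for m ≥ 8 and graphical gates on ORIENTED edges: (C) hitting by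
G_m of every nonzero sum of FOUR gates of one size n whose union support has more than n distinct edges — arbitrary
shared and repeated edges, every union support — and (C′) of every nonzero sum of FOUR SQUARE-FREE gates of any sizes
and any sharing pattern; the free collapse with shared edges and the sizes reduction are tools; NOT claimed: four
gates of one size n with at most n distinct edges in the union when some gate repeats an edge and some edge is shared
by two or three gates (the EDGE-POOR residual of (CL4): it needs a label bound for stuck circuits, not done), five or
more gates (the free recursion meets edge-poor stuck circuits one level down), the k-set label bound, affine
non-graphical forms (β), the leaf regime (γ); nothing here is S-currency, no item closes, stmt-23704 and VP ≠ VNP are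
untouched. (This file holds the two TOOLS; (C) and (C′) are `DefinabilityGapGraphicalFourSurplus`.)

ELEMENTARY · NEW-COMBINATION (LABEL fixed by critic g12, RULING bus 3348, printed verbatim in the module docstring of
`DefinabilityGapGraphicalFourSurplus`) · restricted-model cells of (α″)/(CL4) only · UNDECIDED · IDEA-NEEDED for the
edge-poor residual · 0 S-currency · closes NO item · K1 / stmt-23704 text / VP ≠ VNP untouched. BY-NAME reuse, no
re-proofs, no edits of tree files: `wordL_threeGates_eqCard`, `rename_repL_fourGates`, `collapsed_cond`, `exists_oriented`,
`eprod_map_repL_eq_zero`, `bind₁_wordL_rename_repL`, `bind₁_wordL_eq_zero_of_kiPer`, `kiPer_hits_graphicalThree`,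
`isHomogeneous_kiPer_eprod`. Citations in prose only: Kabanets–Impagliazzo 2003, Nisan–Wigderson 1994 (the lane).
-/

open MvPolynomial
open Literature.Computability.AlgebraicComplexity Literature.Computability.MetaComplexity
open Summit.ValiantsHypothesis.ValiantsHypothesis.Theorems.DefinabilityGapAffineRung
open Summit.ValiantsHypothesis.ValiantsHypothesis.Theorems.DefinabilityGapBlockMerging
open Summit.ValiantsHypothesis.ValiantsHypothesis.Theorems.DefinabilityGapClusterMerging
open Summit.ValiantsHypothesis.ValiantsHypothesis.Theorems.DefinabilityGapForestSums
open Summit.ValiantsHypothesis.ValiantsHypothesis.Theorems.DefinabilityGapSupportRung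
open Summit.ValiantsHypothesis.ValiantsHypothesis.Theorems.DefinabilityGapEdgeGates
open Summit.ValiantsHypothesis.ValiantsHypothesis.Theorems.DefinabilityGapSlideCount
open Summit.ValiantsHypothesis.ValiantsHypothesis.Theorems.DefinabilityGapSlideSupport
open Summit.ValiantsHypothesis.ValiantsHypothesis.Theorems.DefinabilityGapThreeGatesPatched
open Summit.ValiantsHypothesis.ValiantsHypothesis.Theorems.DefinabilityGapGraphicalThree
open Summit.ValiantsHypothesis.ValiantsHypothesis.Theorems.DefinabilityGapFourGatesTools
open Summit.ValiantsHypothesis.ValiantsHypothesis.Theorems.DefinabilityGapGraphicalFour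

set_option linter.dupNamespace false

namespace Summit.ValiantsHypothesis.ValiantsHypothesis.Theorems.DefinabilityGapFourGatesShared

variable {m : ℕ}

/-! ## 1. The free collapse with shared edges -/

/-- (E3a⁺) FREE COLLAPSE WITH SHARED EDGES (fan-in 4, `m ≥ 8`): `e` in the first gate, `ρ_e f ≠ 0`, the other three
gates of one size — NO edge-disjointness: `e` may lie in several gates (those die under `ρ_e`), the survivors are
re-oriented and fed, padded with zero coefficients, to THEOREM A at level `[e]`. -/
theorem kiPer_fourGates_free_shared (hm : 8 ≤ m)
    {F₁ F₂ F₃ F₄ : Multiset ((Fin 3 → Fin (qOf m)) × (Fin 3 → Fin (qOf m)))} {γ₁ γ₂ γ₃ γ₄ : ℂ}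
    (ho : ∀ d ∈ F₁ + F₂ + F₃ + F₄, toLex d.1 < toLex d.2)
    (c₃ : Multiset.card F₃ = Multiset.card F₂) (c₄ : Multiset.card F₄ = Multiset.card F₂)
    {e : (Fin 3 → Fin (qOf m)) × (Fin 3 → Fin (qOf m))} (he : e ∈ F₁)
    (hρ : rename (repL [e]) (C γ₁ * eprod F₁ + C γ₂ * eprod F₂ + C γ₃ * eprod F₃ + C γ₄ * eprod F₄) ≠ 0) :
    bind₁ (kiPer m) (C γ₁ * eprod F₁ + C γ₂ * eprod F₂ + C γ₃ * eprod F₃ + C γ₄ * eprod F₄) ≠ 0 := by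
  intro h0
  have mF₁ : ∀ d ∈ F₁, d ∈ F₁ + F₂ + F₃ + F₄ := fun d hd =>
    Multiset.mem_add.2 (Or.inl (Multiset.mem_add.2 (Or.inl (Multiset.mem_add.2 (Or.inl hd)))))
  have mF₂ : ∀ d ∈ F₂, d ∈ F₁ + F₂ + F₃ + F₄ := fun d hd =>
    Multiset.mem_add.2 (Or.inl (Multiset.mem_add.2 (Or.inl (Multiset.mem_add.2 (Or.inr hd)))))
  have mF₃ : ∀ d ∈ F₃, d ∈ F₁ + F₂ + F₃ + F₄ := fun d hd =>
    Multiset.mem_add.2 (Or.inl (Multiset.mem_add.2 (Or.inr hd)))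
  have mF₄ : ∀ d ∈ F₄, d ∈ F₁ + F₂ + F₃ + F₄ := fun d hd => Multiset.mem_add.2 (Or.inr hd)
  have h54 : 2 * 3 ^ ([e].length + 2) < m * m :=
    lt_of_lt_of_le (by rw [List.length_singleton]; norm_num) (Nat.mul_le_mul hm hm)
  -- TRANSFER + CONTRACT: `φ_[e] (ρ_e f) = φ_[e] f = 0`
  have hρ0 : bind₁ (fun c => wordPoly m (wordL m [e] c))
      (rename (repL [e]) (C γ₁ * eprod F₁ + C γ₂ * eprod F₂ + C γ₃ * eprod F₃ + C γ₄ * eprod F₄)) = 0 := by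
    rw [bind₁_wordL_rename_repL (List.mem_singleton_self e), bind₁_wordL_eq_zero_of_kiPer [e] h0]
  rw [rename_repL_fourGates he] at hρ hρ0
  -- THEOREM A at level `[e]` on any presentation of `ρ_e f` by three oriented live gates of size `|F₂|`
  have key : ∀ (H₂ H₃ H₄ : Multiset ((Fin 3 → Fin (qOf m)) × (Fin 3 → Fin (qOf m)))) (δ₂ δ₃ δ₄ : ℂ),
      Multiset.card H₂ = Multiset.card F₂ → Multiset.card H₃ = Multiset.card F₂ →
      Multiset.card H₄ = Multiset.card F₂ →
      (∀ d ∈ H₂ + H₃ + H₄, toLex d.1 < toLex d.2 ∧ (∀ p ∈ [e], d.1 ≠ p.2) ∧ ∀ p ∈ [e], d.2 ≠ p.2) →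
      C γ₂ * eprod (F₂.map fun d => (repL [e] d.1, repL [e] d.2)) +
          C γ₃ * eprod (F₃.map fun d => (repL [e] d.1, repL [e] d.2)) +
          C γ₄ * eprod (F₄.map fun d => (repL [e] d.1, repL [e] d.2)) =
        C δ₂ * eprod H₂ + C δ₃ * eprod H₃ + C δ₄ * eprod H₄ → False := by
    intro H₂ H₃ H₄ δ₂ δ₃ δ₄ k₂ k₃ k₄ hlive heq
    refine wordL_threeGates_eqCard (List.pairwise_singleton _ e) h54 (Multiset.card F₂) H₂ H₃ H₄ δ₂ δ₃ δ₄
      k₂ k₃ k₄ hlive ?_ ?_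
    · rw [← heq]; exact hρ
    · rw [← heq]; exact hρ0
  -- a SURVIVOR (`e ∉ N ⊆ F₁ + F₂ + F₃ + F₄`): its collapse, re-oriented, is an oriented gate live at `[e]` of the
  -- same size, carrying the coefficient `±γ`
  have surv : ∀ (N : Multiset ((Fin 3 → Fin (qOf m)) × (Fin 3 → Fin (qOf m)))) (γ : ℂ),
      (∀ d ∈ N, d ∈ F₁ + F₂ + F₃ + F₄) → e ∉ N →
      ∃ (G : Multiset ((Fin 3 → Fin (qOf m)) × (Fin 3 → Fin (qOf m)))) (γ' : ℂ),
        Multiset.card G = Multiset.card N ∧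
        (∀ d ∈ G, toLex d.1 < toLex d.2 ∧ (∀ p ∈ [e], d.1 ≠ p.2) ∧ ∀ p ∈ [e], d.2 ≠ p.2) ∧
        C γ * eprod (N.map fun d => (repL [e] d.1, repL [e] d.2)) = C γ' * eprod G := by
    intro N γ hN heN
    have hc := collapsed_cond ho (mF₁ e he) hN heN
    obtain ⟨G, k, hoG, hmG, hs⟩ := exists_oriented fun x hx => (hc x hx).1
    have hlive : ∀ d ∈ G, toLex d.1 < toLex d.2 ∧ (∀ p ∈ [e], d.1 ≠ p.2) ∧ ∀ p ∈ [e], d.2 ≠ p.2 := by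
      intro d hd
      refine ⟨hoG d hd, ?_⟩
      rcases hmG d hd with h | h
      · exact (hc d h).2
      · exact ⟨(hc d.swap h).2.2, (hc d.swap h).2.1⟩
    rcases hs with hs | hs
    · exact ⟨G, γ, by rw [k, Multiset.card_map], hlive, by rw [hs]⟩
    · exact ⟨G, -γ, by rw [k, Multiset.card_map], hlive, by rw [hs, map_neg]; ring⟩
  -- a KILLED slot (`e ∈ N`): its term is `0 = C 0 · eprod G` for any gate `G`
  have kill : ∀ (N G : Multiset ((Fin 3 → Fin (qOf m)) × (Fin 3 → Fin (qOf m)))) (γ : ℂ), e ∈ N →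
      C γ * eprod (N.map fun d => (repL [e] d.1, repL [e] d.2)) = C 0 * eprod G := by
    intro N G γ heN
    rw [eprod_map_repL_eq_zero heN, mul_zero, C_0, zero_mul]
  have live3 : ∀ (H₂ H₃ H₄ : Multiset ((Fin 3 → Fin (qOf m)) × (Fin 3 → Fin (qOf m)))),
      (∀ d ∈ H₂, toLex d.1 < toLex d.2 ∧ (∀ p ∈ [e], d.1 ≠ p.2) ∧ ∀ p ∈ [e], d.2 ≠ p.2) →
      (∀ d ∈ H₃, toLex d.1 < toLex d.2 ∧ (∀ p ∈ [e], d.1 ≠ p.2) ∧ ∀ p ∈ [e], d.2 ≠ p.2) →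
      (∀ d ∈ H₄, toLex d.1 < toLex d.2 ∧ (∀ p ∈ [e], d.1 ≠ p.2) ∧ ∀ p ∈ [e], d.2 ≠ p.2) →
      ∀ d ∈ H₂ + H₃ + H₄, toLex d.1 < toLex d.2 ∧ (∀ p ∈ [e], d.1 ≠ p.2) ∧ ∀ p ∈ [e], d.2 ≠ p.2 := by
    intro H₂ H₃ H₄ l₂ l₃ l₄ d hd
    rcases Multiset.mem_add.1 hd with hd | hd
    · rcases Multiset.mem_add.1 hd with hd | hd
      · exact l₂ d hd
      · exact l₃ d hd
    · exact l₄ d hd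
  -- the membership pattern of `e` in `F₂, F₃, F₄` (killed slots are padded with a survivor and coefficient `0`)
  by_cases e₂ : e ∈ F₂ <;> by_cases e₃ : e ∈ F₃ <;> by_cases e₄ : e ∈ F₄
  · apply hρ
    rw [eprod_map_repL_eq_zero e₂, eprod_map_repL_eq_zero e₃, eprod_map_repL_eq_zero e₄, mul_zero, mul_zero,
      mul_zero, add_zero, add_zero]
  · obtain ⟨G, γ', k, l, eq⟩ := surv F₄ γ₄ mF₄ e₄
    exact key G G G 0 0 γ' (k.trans c₄) (k.trans c₄) (k.trans c₄) (live3 G G G l l l)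
      (by rw [kill F₂ G γ₂ e₂, kill F₃ G γ₃ e₃, eq])
  · obtain ⟨G, γ', k, l, eq⟩ := surv F₃ γ₃ mF₃ e₃
    exact key G G G 0 γ' 0 (k.trans c₃) (k.trans c₃) (k.trans c₃) (live3 G G G l l l)
      (by rw [kill F₂ G γ₂ e₂, kill F₄ G γ₄ e₄, eq])
  · obtain ⟨G₃, γ₃', k₃, l₃, eq₃⟩ := surv F₃ γ₃ mF₃ e₃
    obtain ⟨G₄, γ₄', k₄, l₄, eq₄⟩ := surv F₄ γ₄ mF₄ e₄
    exact key G₃ G₃ G₄ 0 γ₃' γ₄' (k₃.trans c₃) (k₃.trans c₃) (k₄.trans c₄) (live3 G₃ G₃ G₄ l₃ l₃ l₄)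
      (by rw [kill F₂ G₃ γ₂ e₂, eq₃, eq₄])
  · obtain ⟨G, γ', k, l, eq⟩ := surv F₂ γ₂ mF₂ e₂
    exact key G G G γ' 0 0 k k k (live3 G G G l l l) (by rw [eq, kill F₃ G γ₃ e₃, kill F₄ G γ₄ e₄])
  · obtain ⟨G₂, γ₂', k₂, l₂, eq₂⟩ := surv F₂ γ₂ mF₂ e₂
    obtain ⟨G₄, γ₄', k₄, l₄, eq₄⟩ := surv F₄ γ₄ mF₄ e₄
    exact key G₂ G₂ G₄ γ₂' 0 γ₄' k₂ k₂ (k₄.trans c₄) (live3 G₂ G₂ G₄ l₂ l₂ l₄)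
      (by rw [eq₂, kill F₃ G₂ γ₃ e₃, eq₄])
  · obtain ⟨G₂, γ₂', k₂, l₂, eq₂⟩ := surv F₂ γ₂ mF₂ e₂
    obtain ⟨G₃, γ₃', k₃, l₃, eq₃⟩ := surv F₃ γ₃ mF₃ e₃
    exact key G₂ G₃ G₂ γ₂' γ₃' 0 k₂ (k₃.trans c₃) k₂ (live3 G₂ G₃ G₂ l₂ l₃ l₂)
      (by rw [eq₂, eq₃, kill F₄ G₂ γ₄ e₄])
  · obtain ⟨G₂, γ₂', k₂, l₂, eq₂⟩ := surv F₂ γ₂ mF₂ e₂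
    obtain ⟨G₃, γ₃', k₃, l₃, eq₃⟩ := surv F₃ γ₃ mF₃ e₃
    obtain ⟨G₄, γ₄', k₄, l₄, eq₄⟩ := surv F₄ γ₄ mF₄ e₄
    exact key G₂ G₃ G₄ γ₂' γ₃' γ₄' k₂ (k₃.trans c₃) (k₄.trans c₄) (live3 G₂ G₃ G₄ l₂ l₃ l₄)
      (by rw [eq₂, eq₃, eq₄])

/-! ## 2. The sizes reduction -/

/-- SIZES REDUCTION (fan-in 4, `m ≥ 5`): hitting a four-gate circuit reduces to the case of four gates of ONE size —
other size profiles split along homogeneous components into sub-circuits with a zero coefficient, which are graphical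
ΣΠΣ(3) (`kiPer_hits_graphicalThree`). -/
theorem kiPer_hits_graphicalFour_of_eqCard (hm : 5 ≤ m)
    {E₁ E₂ E₃ E₄ : Multiset ((Fin 3 → Fin (qOf m)) × (Fin 3 → Fin (qOf m)))}
    (ho₁ : ∀ e ∈ E₁, toLex e.1 < toLex e.2) (ho₂ : ∀ e ∈ E₂, toLex e.1 < toLex e.2)
    (ho₃ : ∀ e ∈ E₃, toLex e.1 < toLex e.2) (ho₄ : ∀ e ∈ E₄, toLex e.1 < toLex e.2) {α₁ α₂ α₃ α₄ : ℂ}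
    (hE : Multiset.card E₂ = Multiset.card E₁ → Multiset.card E₃ = Multiset.card E₁ →
      Multiset.card E₄ = Multiset.card E₁ →
      bind₁ (kiPer m) (C α₁ * eprod E₁ + C α₂ * eprod E₂ + C α₃ * eprod E₃ + C α₄ * eprod E₄) ≠ 0)
    (hf : C α₁ * eprod E₁ + C α₂ * eprod E₂ + C α₃ * eprod E₃ + C α₄ * eprod E₄ ≠ 0) :
    bind₁ (kiPer m) (C α₁ * eprod E₁ + C α₂ * eprod E₂ + C α₃ * eprod E₃ + C α₄ * eprod E₄) ≠ 0 := by
  have hm0 : 0 < m := by omega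
  -- (Z) a zero coefficient: graphical ΣΠΣ(3), `m ≥ 5`
  have hZ : ∀ γ₁ γ₂ γ₃ γ₄ : ℂ, (γ₁ = 0 ∨ γ₂ = 0 ∨ γ₃ = 0 ∨ γ₄ = 0) →
      C γ₁ * eprod E₁ + C γ₂ * eprod E₂ + C γ₃ * eprod E₃ + C γ₄ * eprod E₄ ≠ 0 →
      bind₁ (kiPer m) (C γ₁ * eprod E₁ + C γ₂ * eprod E₂ + C γ₃ * eprod E₃ + C γ₄ * eprod E₄) ≠ 0 := by
    rintro γ₁ γ₂ γ₃ γ₄ (rfl | rfl | rfl | rfl) hg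
    · rw [C_0, zero_mul, zero_add] at hg ⊢; exact kiPer_hits_graphicalThree hm ho₂ ho₃ ho₄ hg
    · rw [C_0, zero_mul, add_zero] at hg ⊢; exact kiPer_hits_graphicalThree hm ho₁ ho₃ ho₄ hg
    · rw [C_0, zero_mul, add_zero] at hg ⊢; exact kiPer_hits_graphicalThree hm ho₁ ho₂ ho₄ hg
    · rw [C_0, zero_mul, add_zero] at hg ⊢; exact kiPer_hits_graphicalThree hm ho₁ ho₂ ho₃ hg
  by_cases hsz : Multiset.card E₂ = Multiset.card E₁ ∧ Multiset.card E₃ = Multiset.card E₁ ∧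
      Multiset.card E₄ = Multiset.card E₁
  · exact hE hsz.1 hsz.2.1 hsz.2.2
  · -- (S) SIZES: the gates of the size of `E₁` form a proper sub-family; read its homogeneous component
    intro h0
    have hcomp : ∀ n : ℕ, bind₁ (kiPer m)
        (C (if Multiset.card E₁ = n then α₁ else 0) * eprod E₁ +
          C (if Multiset.card E₂ = n then α₂ else 0) * eprod E₂ +
          C (if Multiset.card E₃ = n then α₃ else 0) * eprod E₃ +
          C (if Multiset.card E₄ = n then α₄ else 0) * eprod E₄) = 0 := by
      intro n
      have key : ∀ (N : Multiset ((Fin 3 → Fin (qOf m)) × (Fin 3 → Fin (qOf m)))) (γ : ℂ),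
          homogeneousComponent (n * m) (bind₁ (kiPer m) (C γ * eprod N)) =
            bind₁ (kiPer m) (C (if Multiset.card N = n then γ else 0) * eprod N) := by
        intro N γ
        rw [map_mul, bind₁_C_right, homogeneousComponent_C_mul,
          homogeneousComponent_of_mem (isHomogeneous_kiPer_eprod N), map_mul, bind₁_C_right]
        by_cases hN : Multiset.card N = n
        · rw [if_pos (by rw [hN]), if_pos hN]
        · rw [if_neg (fun h => hN (Nat.eq_of_mul_eq_mul_right hm0 h).symm), if_neg hN, C_0, zero_mul, mul_zero]
      have hc := congrArg (homogeneousComponent (n * m)) h0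
      rw [map_add, map_add, map_add, map_add, map_add, map_add, map_zero, key, key, key, key, ← map_add,
        ← map_add, ← map_add] at hc
      exact hc
    have h1 := hcomp (Multiset.card E₁)
    rw [if_pos rfl] at h1
    have hζ : (if Multiset.card E₂ = Multiset.card E₁ then α₂ else 0) = 0 ∨
        (if Multiset.card E₃ = Multiset.card E₁ then α₃ else 0) = 0 ∨
        (if Multiset.card E₄ = Multiset.card E₁ then α₄ else 0) = 0 := by
      by_cases h2 : Multiset.card E₂ = Multiset.card E₁
      · by_cases h3 : Multiset.card E₃ = Multiset.card E₁
        · exact Or.inr (Or.inr (if_neg fun h4 => hsz ⟨h2, h3, h4⟩))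
        · exact Or.inr (Or.inl (if_neg h3))
      · exact Or.inl (if_neg h2)
    by_cases hf₁ : C α₁ * eprod E₁ + C (if Multiset.card E₂ = Multiset.card E₁ then α₂ else 0) * eprod E₂ +
        C (if Multiset.card E₃ = Multiset.card E₁ then α₃ else 0) * eprod E₃ +
        C (if Multiset.card E₄ = Multiset.card E₁ then α₄ else 0) * eprod E₄ = 0
    · -- the sub-family sum vanishes: `f` is the complementary sum, which has the zero coefficient of `E₁`
      have hite : ∀ (p : Prop) [Decidable p] (a : ℂ) (P : MvPolynomial (Fin 3 → Fin (qOf m)) ℂ),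
          C (if p then a else 0) * P + C (if p then 0 else a) * P = C a * P := by
        intro p _ a P
        by_cases hp : p
        · rw [if_pos hp, if_pos hp, C_0, zero_mul, add_zero]
        · rw [if_neg hp, if_neg hp, C_0, zero_mul, zero_add]
      have hsplit : C α₁ * eprod E₁ + C α₂ * eprod E₂ + C α₃ * eprod E₃ + C α₄ * eprod E₄ =
          (C α₁ * eprod E₁ + C (if Multiset.card E₂ = Multiset.card E₁ then α₂ else 0) * eprod E₂ +
            C (if Multiset.card E₃ = Multiset.card E₁ then α₃ else 0) * eprod E₃ +
            C (if Multiset.card E₄ = Multiset.card E₁ then α₄ else 0) * eprod E₄) +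
          (C 0 * eprod E₁ + C (if Multiset.card E₂ = Multiset.card E₁ then 0 else α₂) * eprod E₂ +
            C (if Multiset.card E₃ = Multiset.card E₁ then 0 else α₃) * eprod E₃ +
            C (if Multiset.card E₄ = Multiset.card E₁ then 0 else α₄) * eprod E₄) := by
        rw [C_0, zero_mul, zero_add, ← hite (Multiset.card E₂ = Multiset.card E₁) α₂ (eprod E₂),
          ← hite (Multiset.card E₃ = Multiset.card E₁) α₃ (eprod E₃),
          ← hite (Multiset.card E₄ = Multiset.card E₁) α₄ (eprod E₄)]
        ring
      rw [hf₁, zero_add] at hsplit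
      refine hZ 0 (if Multiset.card E₂ = Multiset.card E₁ then 0 else α₂)
        (if Multiset.card E₃ = Multiset.card E₁ then 0 else α₃)
        (if Multiset.card E₄ = Multiset.card E₁ then 0 else α₄)
        (Or.inl rfl) ?_ ?_
      · rw [← hsplit]; exact hf
      · rw [← hsplit]; exact h0
    · exact hZ α₁ _ _ _ (Or.inr hζ) hf₁ h1

end Summit.ValiantsHypothesis.ValiantsHypothesis.Theorems.DefinabilityGapFourGatesShared
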